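import Summits.BirchSwinnertonDyer.BirchSwinnertonDyer.Theorems.MordellShaFreeCutLocNonDegeneracy
import Summits.BirchSwinnertonDyer.BirchSwinnertonDyer.Theses.CongruentShaFreeCut
import Literature.NumberTheory.EllipticCurves.Kriz2020.GoldfeldJ1728Proofs

set_option autoImplicit false

/-! # Route `CongruentShaFreeCut` (rung S2) — crux `RankPosOfTwoSelmerCorankOne`
(stmt-BirchSwinnertonDyer-19079), line `heegner-field-links` v5: the (res) stub `stub_twoLocNonDegeneracy`
HOLDS at rank-one data and is IMPLIED by crux A

Cell `bsd-cn100`; filed by the prover seat `bsd-cn100-s2b-c3` g3 as service for the S2 residual (the S2 twin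
of `MordellShaFreeCutLocNonDegeneracy`, p435058). Supports, does not close, stmt-BirchSwinnertonDyer-19079
(`--supports … --as helper`). HONEST FRAMING: nothing here proves crux A `RankPosOfTwoSelmerCorankOne`, crux B,
the leaf `rankOne_twoConverse_congruentNumber`, the congruent number problem or any case of BSD.

* `twoLocNonDegeneracy_of_rankOne` — the registered `stub_twoLocNonDegeneracy` statement (v5 skeleton
  e11896bb) with `corank_{ℤ₂} Sel_{2^∞}(E_n/K) = 1` replaced by `rank E_n(K) = 1 ∧ #Ш(E_n/K)[2^∞] < ∞`:
  a THEOREM (the generic `MordellShaFreeCutLocNonDegeneracy.locNonDegeneracy_of_rankOne` at `p = 2`: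
  Skinner's Lemma `rank1lemma` at the completions above `2`).
* **`twoLocNonDegeneracy_of_cruxA`** — crux A implies the registered (res) stub VERBATIM, from TREE
  THEOREMS only: `corank(E_n/K) = corank(E_n/ℚ) + corank(E_n^{(d_K)}/ℚ)` (Dokchitser–Dokchitser 2010
  Lemma 4.14, `selmerCorank_baseChange_quadratic_holds`, valid at `p = 2`), `rank E_n(K) = rank E_n(ℚ) +
  rank E_n^{(d_K)}(ℚ)` (`mordellWeilRank_baseChange_quadratic_holds`), `E_n^{(d)} = E_{n|d|}` as
  Weierstrass models (`quadraticTwist_congruentNumberCurve`, Kriz2020/GoldfeldJ1728Proofs), `corank = rank + corank Ш`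
  (`selmerCorank_eq_mordellWeilRank_add_holds`): corank one over `K` puts corank one on exactly one of
  `E_n`, `E_{n|d_K|}`, crux A gives it a rational point of infinite order, so `1 ≤ rank E_n(K) ≤ 1`,
  `#Ш(E_n/K)[2^∞] < ∞`, and the first bullet concludes. Hence (res) at `2` is a CONSEQUENCE of crux A
  used toward crux A: the v5 cut loses nothing.

[cite: Skinner2020, §2.2 (Lemma rank1lemma) and §3] [cite: DokchitserDokchitserAnnals2010, Lemma 4.14]
[cite: Kriz2020, §10.3 (v5), definition of the quadratic twist E^d] [cite: Greenberg1999LNM, §1 pp. 54–57] -/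

noncomputable section

open scoped Classical

namespace Summit.BirchSwinnertonDyer.BirchSwinnertonDyer.Theorems.CongruentShaFreeCutLocNonDegeneracy

open WeierstrassCurve NumberField IsDedekindDomain Field
open Literature.NumberTheory.EllipticCurves
open Summit.BirchSwinnertonDyer.Rank1Residual.X11b
open Summit.BirchSwinnertonDyer.BirchSwinnertonDyer.Theses.CongruentShaFreeCut
open Summit.BirchSwinnertonDyer.BirchSwinnertonDyer.Theorems.MordellShaFreeCutLocNonDegeneracy
  (locNonDegeneracy_of_rankOne)

/-- **`stub_twoLocNonDegeneracy` at rank-one data**: for square-free `n`, an imaginary quadratic `K` with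
the Heegner hypothesis for `2`, `rank E_n(K) = 1` and `#Ш(E_n/K)[2^∞] < ∞`, the `w`-strict `2^∞`-Selmer
group of `E_n/K` is finite at every `w ∣ 2` — `locNonDegeneracy_of_rankOne` at `p = 2`.
[cite: Skinner2020, §2.2 (Lemma rank1lemma) and §3] -/
theorem twoLocNonDegeneracy_of_rankOne :
    ∀ ⦃n : ℕ⦄, Squarefree n → ∀ (K : Type) [Field K] [NumberField K],
      IsImaginaryQuadratic K → SatisfiesHeegnerHypothesis 2 K →
        ((congruentNumberCurve n).baseChange K).mordellWeilRank = 1 →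
        Finite (AddCommGroup.primaryComponent ((congruentNumberCurve n).baseChange K).sha 2) →
      ∀ (w : HeightOneSpectrum (𝓞 K)), ((2 : ℕ) : 𝓞 K) ∈ w.asIdeal →
        Finite ↥(((congruentNumberCurve n).baseChange K).selmerGroupPInfty 2 ⊓
          selmerLocalKerPrimaryTorsion ((congruentNumberCurve n).baseChange K) (w.adicCompletion K) 2) := by
  intro n hn K _ _ hK hH2 hrank hsha w hw
  haveI : Fact (Nat.Prime 2) := ⟨Nat.prime_two⟩
  haveI := isElliptic_congruentNumberCurve hn.ne_zero
  exact locNonDegeneracy_of_rankOne (congruentNumberCurve n) 2 K hK (hH2 2 Nat.prime_two (dvd_refl 2))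
    hrank hsha w hw

/-- **Crux A `RankPosOfTwoSelmerCorankOne` implies the registered (res) stub `stub_twoLocNonDegeneracy`
(statement VERBATIM)**, from TREE THEOREMS only: the corank and rank decompositions over the quadratic
field (`selmerCorank_baseChange_quadratic_holds` at `p = 2`, `mordellWeilRank_baseChange_quadratic_holds`),
`E_n^{(d_K)} = E_{n|d_K|}` (`quadraticTwist_congruentNumberCurve`, Kriz2020/GoldfeldJ1728Proofs), the corank identity
(`selmerCorank_eq_mordellWeilRank_add_holds`, `finite_primaryComponent_sha_iff_shaCorank_eq_zero`) and
`twoLocNonDegeneracy_of_rankOne`. Nothing is asserted about crux A.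
[cite: DokchitserDokchitserAnnals2010, Lemma 4.14] [cite: Skinner2020, §2.2 (Lemma rank1lemma) and §3]
[cite: Kriz2020, §10.3 (v5), definition of the quadratic twist E^d] -/
theorem twoLocNonDegeneracy_of_cruxA (hA : RankPosOfTwoSelmerCorankOne) :
    ∀ ⦃n : ℕ⦄, Squarefree n → ∀ (K : Type) [Field K] [NumberField K],
      IsImaginaryQuadratic K → SatisfiesHeegnerHypothesis 2 K →
        ((congruentNumberCurve n).baseChange K).selmerCorank 2 = 1 →
      ∀ (w : HeightOneSpectrum (𝓞 K)), ((2 : ℕ) : 𝓞 K) ∈ w.asIdeal →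
        Finite ↥(((congruentNumberCurve n).baseChange K).selmerGroupPInfty 2 ⊓
          selmerLocalKerPrimaryTorsion ((congruentNumberCurve n).baseChange K) (w.adicCompletion K) 2) := by
  intro n hn K _ _ hK hH2 hcK w hw
  haveI : Fact (Nat.Prime 2) := ⟨Nat.prime_two⟩
  have hn0 : n ≠ 0 := hn.ne_zero
  haveI hE := isElliptic_congruentNumberCurve hn0
  haveI hEK : ((congruentNumberCurve n).baseChange K).IsElliptic := by rw [baseChange]; infer_instance
  -- the twist `E_n^{(d_K)} = E_{n|d_K|}`, an elliptic congruent number curve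
  set m : ℕ := n * (NumberField.discr K).natAbs with hm
  have hm0 : m ≠ 0 :=
    mul_ne_zero hn0 (Int.natAbs_ne_zero.mpr (NumberField.discr_ne_zero K))
  have htw : (congruentNumberCurve n).quadraticTwist (NumberField.discr K : ℚ) = congruentNumberCurve m :=
    quadraticTwist_congruentNumberCurve n (NumberField.discr K)
  haveI hEm := isElliptic_congruentNumberCurve hm0
  haveI hEd : ((congruentNumberCurve n).quadraticTwist (NumberField.discr K : ℚ)).IsElliptic := htw ▸ hEm
  -- the two decompositions over the quadratic field
  have hdec : ((congruentNumberCurve n).baseChange K).selmerCorank 2 =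
      (congruentNumberCurve n).selmerCorank 2 +
        ((congruentNumberCurve n).quadraticTwist (NumberField.discr K : ℚ)).selmerCorank 2 :=
    selmerCorank_baseChange_quadratic_holds (congruentNumberCurve n) K hK.1 2
  have hrkdec : ((congruentNumberCurve n).baseChange K).mordellWeilRank =
      (congruentNumberCurve n).mordellWeilRank +
        ((congruentNumberCurve n).quadraticTwist (NumberField.discr K : ℚ)).mordellWeilRank :=
    mordellWeilRank_baseChange_quadratic_holds (congruentNumberCurve n) K hK.1
  rw [hcK] at hdec
  rw [htw] at hdec hrkdec
  -- a point of infinite order over `K`, from crux A on `E_n` or on `E_{n|d_K|}`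
  have hrk1 : 1 ≤ ((congruentNumberCurve n).baseChange K).mordellWeilRank := by
    rcases Nat.eq_zero_or_pos ((congruentNumberCurve n).selmerCorank 2) with h0 | hpos
    · have hcm : (congruentNumberCurve m).selmerCorank 2 = 1 := by omega
      have h1 := hA hm0 hcm
      rw [hrkdec]; omega
    · have hcn : (congruentNumberCurve n).selmerCorank 2 = 1 := by omega
      have h1 := hA hn0 hcn
      rw [hrkdec]; omega
  -- `rank ≤ corank = 1`: rank one and `Ш[2^∞]` of corank zero, i.e. finite
  have hid : ((congruentNumberCurve n).baseChange K).selmerCorank 2 =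
      ((congruentNumberCurve n).baseChange K).mordellWeilRank +
        ((congruentNumberCurve n).baseChange K).shaCorank 2 :=
    ((congruentNumberCurve n).baseChange K).selmerCorank_eq_mordellWeilRank_add_holds 2
  rw [hcK] at hid
  have hrank : ((congruentNumberCurve n).baseChange K).mordellWeilRank = 1 := by omega
  have hsha0 : ((congruentNumberCurve n).baseChange K).shaCorank 2 = 0 := by omega
  have hsha : Finite (AddCommGroup.primaryComponent ((congruentNumberCurve n).baseChange K).sha 2) :=
    (finite_primaryComponent_sha_iff_shaCorank_eq_zero ((congruentNumberCurve n).baseChange K) 2).2 hsha0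
  exact twoLocNonDegeneracy_of_rankOne hn K hK hH2 hrank hsha w hw

end Summit.BirchSwinnertonDyer.BirchSwinnertonDyer.Theorems.CongruentShaFreeCutLocNonDegeneracy

end
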